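import Summits.QuantumFields.BalabanUV.Beta.GAN24.AveragedPropagatorTwoLevel
import Literature.MathematicalPhysics.QuantumFieldTheory.Balaban1983to89.B5Eq194DivG

/-!
# G-an2-4 ∕ (CONV-C), road P2, route R2-S1, VECTOR LAYER, PART 12 — THE FINE SOFT VECTOR MINIMISER `M̃ = a𝒢Q*` ([B5] (1.71)∕(1.74)):
# ITS EXACT TWO-LEVEL IDENTITY, WITH THE NON-LOCAL RESIDUAL LOCATED AS THE TWO-LEVEL DEFECT OF ONE ORDER-ZERO IDEMPOTENT —
# the «R-longitudinal projector» `Π_R := 𝒢∂R∂ᴴ = (1 − a𝒢Q*Q)·∂Δ⁻¹∂ᴴ`, which annihilates the soft field itself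

Unit `b2b-balaban-gan24-p2` (gen 30), BINDER row G-an2-4 ∕ (CONV-C), road P2; crux team (2).  Parts 3–11 settled the UNIT-LATTICE-READ vector
constituents `Q𝒢Q*`, `(Q𝒢Q*)⁻¹` (both (CONV-C) clauses, unconditional at a = 1 on cubic tori) because the non-local `∂R∂ᴴ` part of
`Δ_a = locOp + ∂·RT·∂ᴴ` drops under the sandwich `Q′𝒢′(·)𝒢Q*` by (1.95).  For the FINE objects (the soft minimiser `M̃ = a𝒢Q*`, hence
`H_k = M̃·(aQ𝒢Q*)⁻¹`) only the RIGHT identity `RT∂ᴴ𝒢Q* = 0` is available; THIS FILE shows exactly what is left: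
 * §1 **`projR n M a := (DeltaA n M a)⁻¹ * ∂ * RT * ∂ᴴ`**; **`projR_mul_projR`** (idempotent, from (1.97) `∂ᴴ𝒢∂R = R`);
   **`projR_mul_inv_mul_QvAdj`**: `Π_R·(𝒢Q*) = 0` ((1.95)); **`inv_mul_GradOp_mul_RT`**: `𝒢∂R = (1 − a•𝒢Q*Q)·∂Δ⁻¹`, hence
   **`projR_eq`**: `Π_R = (1 − a•𝒢Q*Q)·∂Δ⁻¹∂ᴴ` — the longitudinal projector `∂Δ⁻¹∂ᴴ` dressed by `𝒢Δ₀ = 1 − a𝒢Q*Q`;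
 * §2 **`MsoftV n M a := (a:ℂ) • ((DeltaA n M a)⁻¹ * QvAdj n M)`** and **`MsoftV_succ_sub`** (every d, torus, a > 0, N R ≥ 1):
   `M̃_{RN} − (J⊗1)M̃_N = a•( 𝒢′E₂ − 𝒢′(locOp′(J⊗1) − (J⊗1)locOp)𝒢Q* − (Π′_R(J⊗1) − (J⊗1)Π_R)·𝒢Q* )` — LOCAL terms (letters in the tree
   at a = 1 cubic: Parts 4–6) plus THE TWO-LEVEL DEFECT OF `Π_R` APPLIED TO THE SOFT FIELD `𝒢Q*`.
READING (located, not claimed; see §3 (v2) for WHY it is an equivalence and not a reduction — `Π_R = 1 − 𝒢·locOp`): the fine (O-pos)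
one-step law of `M̃` (and of `H_k`) at `U = 1` is EQUIVALENT, modulo tree letters, to a
SMOOTHING-TESTED two-level rate of the order-zero idempotent `Π_R` on the (Lipschitz, exponentially localized) soft fields — R7's item (ρ2)
«order-zero pieces, smoothing-tested; no rate in ℓ² → ℓ²» identified exactly; inputs in tree toward it: the letters for `𝒢∂ᴴ`-type blocks and
(1.126) `B5DPD126Uniform.dpd_decay_uniform` ∕ `B5Decay126` for `∂R∂ᴴ`.
HONEST SCOPE.  Exact finite-lattice operator algebra over the tree's (1.95)∕(1.97) and Laplacian identities BY NAME; `U = 1`; no estimate; 2 bookkeeping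
defs; [folklore]; kernel-checked, no `sorry`.  [Balaban1984PropagatorsI] (1.69)–(1.74), (1.95), (1.97) are TEXT LOCATIONS.  NOT (CONV-C), NEVER «G-an2-4
closed», NOT NE2, NOT D1, NOT BetaPertH, NOT continuum, NOT Clay; not in print — our bookkeeping.  HONEST DEPENDENCY: continuum YM on T⁴ ⇐ BetaPertH
∧ nine spine estimates (0/9 proved); BetaPertH ⇐ (D1) ∧ (D4) ∧ CAP+tail; G-an2-4 gates asym, D1 and NE2/3/4.
-/

noncomputable section

open scoped BigOperators ComplexConjugate Matrix

namespace Summit.QuantumFields.BalabanUV.Beta.GAN24.SoftVectorMinimiserTwoLevel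

open Literature.MathematicalPhysics.QuantumFieldTheory.Balaban1983to89
open B5Prop11Plancherel (Tor fine)
open B5Prop11Lower (Lap)
open B5Action121 (GradOp LapS GradOp_conjTranspose_mul_GradOp)
open B5Block118 (QvOp)
open B5DeltaA169 (DeltaA QvAdj isUnit_DeltaA)
open B5LaplaceInverse (LapSinv Pker LapS_mul_LapSinv Pker_mul_Pker)
open B5Value126 (PcT)
open B5Identities197Torus (RT RT_mul_RT eq195_left eq197_right)
open B5Eq194DivG (RT_mul_Pker)
open B5Hk160Torus (Lap_GradOp_mulVec)
open Beta.VectorPropagatorDict (ext_of_mulVec')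
open Summit.QuantumFields.BalabanUV.Beta.GAN24.StaircaseAveragingDefect (stairV fwdDefect adjDefect)
open Summit.QuantumFields.BalabanUV.Beta.GAN24.AveragedPropagatorTwoLevel (locOp DeltaA_eq_locOp_add resolvent_stairV)

variable {d : ℕ}

/-! ## §1 The R-longitudinal projector `Π_R = 𝒢∂R∂ᴴ` -/

section OneLevel

variable (n : ℕ) [NeZero n] (M : Fin d → ℕ) [hM : ∀ μ, NeZero (M μ)] (a : ℝ)

/-- **the R-longitudinal projector** `Π_R := 𝒢·∂·R·∂ᴴ` (`𝒢 = Δ_a⁻¹`, `R = RT` the p. 25 projection). [folklore] -/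
def projR : Matrix (Tor (fine n M) × Fin d) (Tor (fine n M) × Fin d) ℂ :=
  (DeltaA n M a)⁻¹ * GradOp (fine n M) (n : ℂ) * RT n M * (GradOp (fine n M) (n : ℂ))ᴴ

/-- **the vector soft minimiser** `M̃ := a•𝒢Q*` (the solution operator of (1.73) with source `aQ*v`, [B5] (1.71)∕(1.74)). [folklore] -/
def MsoftV : Matrix (Tor (fine n M) × Fin d) (Tor M × Fin d) ℂ := (a : ℂ) • ((DeltaA n M a)⁻¹ * QvAdj n M)

/-- **`Π_R` is idempotent** (from (1.97) `∂ᴴ𝒢∂R = R` and `R² = R`). [folklore] -/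
theorem projR_mul_projR (ha : 0 < a) : projR n M a * projR n M a = projR n M a := by
  have hn : 1 ≤ n := Nat.one_le_iff_ne_zero.mpr (NeZero.ne n)
  have h97 := eq197_right n hn M a ha   -- ∂ᴴ * 𝒢 * ∂ * RT = RT
  have e : projR n M a * projR n M a
      = (DeltaA n M a)⁻¹ * GradOp (fine n M) (n : ℂ) * RT n M
          * ((GradOp (fine n M) (n : ℂ))ᴴ * (DeltaA n M a)⁻¹ * GradOp (fine n M) (n : ℂ) * RT n M)
          * (GradOp (fine n M) (n : ℂ))ᴴ := by
    simp only [projR, Matrix.mul_assoc]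
  rw [e, h97, Matrix.mul_assoc _ (RT n M) (RT n M), RT_mul_RT, projR]

/-- **`Π_R` annihilates the soft field**: `Π_R·(𝒢Q*) = 0` ((1.95) `R∂ᴴ𝒢Q* = 0`). [folklore] -/
theorem projR_mul_inv_mul_QvAdj (ha : 0 < a) : projR n M a * ((DeltaA n M a)⁻¹ * QvAdj n M) = 0 := by
  have hn : 1 ≤ n := Nat.one_le_iff_ne_zero.mpr (NeZero.ne n)
  have h95 := eq195_left n hn M a ha   -- RT * ∂ᴴ * 𝒢 * Q* = 0
  have e : projR n M a * ((DeltaA n M a)⁻¹ * QvAdj n M)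
      = (DeltaA n M a)⁻¹ * GradOp (fine n M) (n : ℂ) * (RT n M * (GradOp (fine n M) (n : ℂ))ᴴ * (DeltaA n M a)⁻¹ * QvAdj n M) := by
    simp only [projR, Matrix.mul_assoc]
  rw [e, h95, Matrix.mul_zero]

/-- **`Δ_a·∂·Δ⁻¹ = ∂·R + a•Q*Q·∂·Δ⁻¹`** (on vector fields; `Δ⁻¹ = LapSinv` the scalar pseudo-inverse): `Lap∂ = ∂Δ_s`, `∂ᴴ∂ = Δ_s`,
`Δ_sΔ⁻¹ = 1 − P_const`, `(1 − P)(1 − P_const) = R`. [folklore] -/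
theorem DeltaA_mul_GradOp_mul_LapSinv :
    DeltaA n M a * GradOp (fine n M) (n : ℂ) * LapSinv (fine n M) (n : ℂ)
      = GradOp (fine n M) (n : ℂ) * RT n M
        + (a : ℂ) • (QvAdj n M * QvOp n M * GradOp (fine n M) (n : ℂ) * LapSinv (fine n M) (n : ℂ)) := by
  -- `Lap * ∂ = ∂ * LapS` as matrices
  have hLap : Lap n M * GradOp (fine n M) (n : ℂ) = GradOp (fine n M) (n : ℂ) * LapS (fine n M) (n : ℂ) :=
    ext_of_mulVec' fun s => by rw [← Matrix.mulVec_mulVec, ← Matrix.mulVec_mulVec, Lap_GradOp_mulVec]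
  -- `RT = (1 − PcT)(1 − Pker)`
  have hRT : (1 - PcT n M (n : ℂ)) * (1 - Pker (fine n M) (n : ℂ)) = RT n M := by
    have h1 : (1 : Matrix (Tor (fine n M)) (Tor (fine n M)) ℂ) - PcT n M (n : ℂ) = RT n M + Pker (fine n M) (n : ℂ) := by
      rw [RT]; abel
    rw [h1, Matrix.add_mul, Matrix.mul_sub, Matrix.mul_one, RT_mul_Pker, sub_zero, Matrix.mul_sub, Matrix.mul_one, Pker_mul_Pker,
      sub_self, add_zero]
  have h1 : Lap n M * GradOp (fine n M) (n : ℂ) * LapSinv (fine n M) (n : ℂ) = GradOp (fine n M) (n : ℂ) * (1 - Pker (fine n M) (n : ℂ)) := by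
    rw [hLap, Matrix.mul_assoc, LapS_mul_LapSinv]
  have h2 : GradOp (fine n M) (n : ℂ) * PcT n M (n : ℂ) * (GradOp (fine n M) (n : ℂ))ᴴ * GradOp (fine n M) (n : ℂ) * LapSinv (fine n M) (n : ℂ)
      = GradOp (fine n M) (n : ℂ) * (PcT n M (n : ℂ) * (1 - Pker (fine n M) (n : ℂ))) := by
    rw [Matrix.mul_assoc (GradOp (fine n M) (n : ℂ) * PcT n M (n : ℂ)) ((GradOp (fine n M) (n : ℂ))ᴴ), GradOp_conjTranspose_mul_GradOp,
      Matrix.mul_assoc (GradOp (fine n M) (n : ℂ) * PcT n M (n : ℂ)), LapS_mul_LapSinv, Matrix.mul_assoc]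
  rw [DeltaA]
  simp only [Matrix.add_mul, Matrix.sub_mul, Matrix.smul_mul]
  rw [h1, h2, ← hRT]
  simp only [Matrix.sub_mul, Matrix.one_mul, Matrix.mul_sub, Matrix.mul_one, Matrix.mul_assoc]
  abel

/-- **`𝒢∂R = (1 − a•𝒢Q*Q)·∂Δ⁻¹`** (multiply `DeltaA_mul_GradOp_mul_LapSinv` by `𝒢 = Δ_a⁻¹`). [folklore] -/
theorem inv_mul_GradOp_mul_RT (ha : 0 < a) :
    (DeltaA n M a)⁻¹ * GradOp (fine n M) (n : ℂ) * RT n M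
      = (1 - (a : ℂ) • ((DeltaA n M a)⁻¹ * QvAdj n M * QvOp n M)) * GradOp (fine n M) (n : ℂ) * LapSinv (fine n M) (n : ℂ) := by
  have hn : 1 ≤ n := Nat.one_le_iff_ne_zero.mpr (NeZero.ne n)
  have hinv : (DeltaA n M a)⁻¹ * DeltaA n M a = 1 :=
    Matrix.nonsing_inv_mul _ ((Matrix.isUnit_iff_isUnit_det _).mp (isUnit_DeltaA n hn M a ha))
  have h := congrArg (fun X => (DeltaA n M a)⁻¹ * X) (DeltaA_mul_GradOp_mul_LapSinv n M a)
  simp only [← Matrix.mul_assoc, hinv, Matrix.one_mul, Matrix.mul_add, Matrix.mul_smul] at h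
  -- h : ∂Δ⁻¹ = 𝒢∂R + a•(𝒢Q*Q∂Δ⁻¹)
  rw [Matrix.sub_mul, Matrix.sub_mul, Matrix.one_mul, Matrix.smul_mul, Matrix.smul_mul, h]
  simp only [Matrix.mul_assoc]
  abel

/-- **`Π_R = (1 − a•𝒢Q*Q)·∂Δ⁻¹∂ᴴ`** — the longitudinal projector dressed by `𝒢Δ₀`. [folklore] -/
theorem projR_eq (ha : 0 < a) :
    projR n M a = (1 - (a : ℂ) • ((DeltaA n M a)⁻¹ * QvAdj n M * QvOp n M)) * GradOp (fine n M) (n : ℂ)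
      * LapSinv (fine n M) (n : ℂ) * (GradOp (fine n M) (n : ℂ))ᴴ := by
  rw [projR, inv_mul_GradOp_mul_RT n M a ha]

end OneLevel

/-! ## §2 The fine soft minimiser's two-level identity, residual located -/

section TwoLevel

variable (N R : ℕ) [NeZero N] [NeZero R] (M : Fin d → ℕ) [hM : ∀ μ, NeZero (M μ)] (a : ℝ)

/-- **THE TWO-LEVEL IDENTITY OF THE VECTOR SOFT MINIMISER, RESIDUAL LOCATED**: for every `N, R ≥ 1`, every torus, every `a > 0`,
`M̃_{RN} − (J⊗1)M̃_N = a•( 𝒢′E₂ − 𝒢′(locOp′(J⊗1) − (J⊗1)locOp)𝒢Q* − (Π′_R(J⊗1) − (J⊗1)Π_R)·𝒢Q* )` — the first two terms are LOCAL (every letter in the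
tree at a = 1 cubic), the third is the two-level defect of the order-zero idempotent `Π_R` applied to the soft field `𝒢Q*` (which `Π_R` annihilates);
the right gauge term `(J⊗1)∂R∂ᴴ𝒢Q*` vanished by (1.95). [folklore] -/
theorem MsoftV_succ_sub (ha : 0 < a) :
    MsoftV (R * N) M a - stairV N R M * MsoftV N M a
      = (a : ℂ) • ((DeltaA (R * N) M a)⁻¹ * adjDefect N R M
          - (DeltaA (R * N) M a)⁻¹ * (locOp (R * N) M a * stairV N R M - stairV N R M * locOp N M a) * ((DeltaA N M a)⁻¹ * QvAdj N M)
          - (projR (R * N) M a * stairV N R M - stairV N R M * projR N M a) * ((DeltaA N M a)⁻¹ * QvAdj N M)) := by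
  have hN : 1 ≤ N := Nat.one_le_iff_ne_zero.mpr (NeZero.ne N)
  have h95 := eq195_left N hN M a ha
  have hres := resolvent_stairV N R M a ha
  have hann := projR_mul_inv_mul_QvAdj N M a ha
  -- abbreviations-free bookkeeping
  have hE2 : QvAdj (R * N) M = adjDefect N R M + stairV N R M * QvAdj N M := by rw [adjDefect]; abel
  -- the `∂R∂ᴴ` split of the defect, with the right term killed by (1.95) and the left term written through `Π′_R`
  have hsplit : (DeltaA (R * N) M a)⁻¹ * (DeltaA (R * N) M a * stairV N R M - stairV N R M * DeltaA N M a) * ((DeltaA N M a)⁻¹ * QvAdj N M)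
      = (DeltaA (R * N) M a)⁻¹ * (locOp (R * N) M a * stairV N R M - stairV N R M * locOp N M a) * ((DeltaA N M a)⁻¹ * QvAdj N M)
        + projR (R * N) M a * stairV N R M * ((DeltaA N M a)⁻¹ * QvAdj N M) := by
    have e1 : DeltaA (R * N) M a * stairV N R M - stairV N R M * DeltaA N M a
        = (locOp (R * N) M a * stairV N R M - stairV N R M * locOp N M a)
          + (GradOp (fine (R * N) M) ((R * N : ℕ) : ℂ) * RT (R * N) M * (GradOp (fine (R * N) M) ((R * N : ℕ) : ℂ))ᴴ * stairV N R M
              - stairV N R M * (GradOp (fine N M) ((N : ℕ) : ℂ) * RT N M * (GradOp (fine N M) ((N : ℕ) : ℂ))ᴴ)) := by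
      rw [DeltaA_eq_locOp_add, DeltaA_eq_locOp_add]
      simp only [Matrix.add_mul, Matrix.mul_add]
      abel
    have t2 : (DeltaA (R * N) M a)⁻¹ * (stairV N R M * (GradOp (fine N M) ((N : ℕ) : ℂ) * RT N M * (GradOp (fine N M) ((N : ℕ) : ℂ))ᴴ))
        * ((DeltaA N M a)⁻¹ * QvAdj N M) = 0 := by
      have : (DeltaA (R * N) M a)⁻¹ * (stairV N R M * (GradOp (fine N M) ((N : ℕ) : ℂ) * RT N M * (GradOp (fine N M) ((N : ℕ) : ℂ))ᴴ))
          * ((DeltaA N M a)⁻¹ * QvAdj N M)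
          = (DeltaA (R * N) M a)⁻¹ * stairV N R M * GradOp (fine N M) ((N : ℕ) : ℂ)
            * (RT N M * (GradOp (fine N M) ((N : ℕ) : ℂ))ᴴ * (DeltaA N M a)⁻¹ * QvAdj N M) := by
        simp only [Matrix.mul_assoc]
      rw [this, h95, Matrix.mul_zero]
    have t1 : (DeltaA (R * N) M a)⁻¹ * (GradOp (fine (R * N) M) ((R * N : ℕ) : ℂ) * RT (R * N) M * (GradOp (fine (R * N) M) ((R * N : ℕ) : ℂ))ᴴ
        * stairV N R M) * ((DeltaA N M a)⁻¹ * QvAdj N M) = projR (R * N) M a * stairV N R M * ((DeltaA N M a)⁻¹ * QvAdj N M) := by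
      simp only [projR, Matrix.mul_assoc]
    have t12 : (DeltaA (R * N) M a)⁻¹
        * (GradOp (fine (R * N) M) ((R * N : ℕ) : ℂ) * RT (R * N) M * (GradOp (fine (R * N) M) ((R * N : ℕ) : ℂ))ᴴ * stairV N R M
            - stairV N R M * (GradOp (fine N M) ((N : ℕ) : ℂ) * RT N M * (GradOp (fine N M) ((N : ℕ) : ℂ))ᴴ))
        * ((DeltaA N M a)⁻¹ * QvAdj N M) = projR (R * N) M a * stairV N R M * ((DeltaA N M a)⁻¹ * QvAdj N M) := by
      rw [Matrix.mul_sub, Matrix.sub_mul, t1, t2, sub_zero]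
    rw [e1, Matrix.mul_add, Matrix.add_mul, t12]
  -- `Π′_R J (𝒢Q*) = (Π′_R J − J Π_R)(𝒢Q*)` since `Π_R(𝒢Q*) = 0`
  have hcomm : projR (R * N) M a * stairV N R M * ((DeltaA N M a)⁻¹ * QvAdj N M)
      = (projR (R * N) M a * stairV N R M - stairV N R M * projR N M a) * ((DeltaA N M a)⁻¹ * QvAdj N M) := by
    rw [Matrix.sub_mul, Matrix.mul_assoc (stairV N R M) (projR N M a), hann, Matrix.mul_zero, sub_zero]
  calc MsoftV (R * N) M a - stairV N R M * MsoftV N M a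
      = (a : ℂ) • ((DeltaA (R * N) M a)⁻¹ * QvAdj (R * N) M - stairV N R M * ((DeltaA N M a)⁻¹ * QvAdj N M)) := by
        rw [MsoftV, MsoftV, Matrix.mul_smul, smul_sub]
    _ = (a : ℂ) • ((DeltaA (R * N) M a)⁻¹ * adjDefect N R M
          + ((DeltaA (R * N) M a)⁻¹ * stairV N R M - stairV N R M * (DeltaA N M a)⁻¹) * QvAdj N M) := by
        rw [hE2]; congr 1
        simp only [Matrix.mul_add, Matrix.sub_mul, Matrix.mul_assoc]; abel
    _ = (a : ℂ) • ((DeltaA (R * N) M a)⁻¹ * adjDefect N R M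
          - (DeltaA (R * N) M a)⁻¹ * (DeltaA (R * N) M a * stairV N R M - stairV N R M * DeltaA N M a) * ((DeltaA N M a)⁻¹ * QvAdj N M)) := by
        rw [hres]; congr 1
        simp only [Matrix.neg_mul, Matrix.mul_assoc]; abel
    _ = _ := by rw [hsplit, hcomm]; congr 1; abel

end TwoLevel

/-! ## §3 (v2 append) `Π_R = 1 − 𝒢·locOp` — why §2 is an EQUIVALENT reformulation, not a reduction -/

section Circularity

variable (n : ℕ) [NeZero n] (M : Fin d → ℕ) [hM : ∀ μ, NeZero (M μ)] (a : ℝ)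

/-- **`Π_R = 1 − 𝒢·locOp`**: since `Δ_a = locOp + ∂·RT·∂ᴴ` and `𝒢Δ_a = 1`.  CONSEQUENCE (honest, recorded for the route tables): the
«residual» `(Π′_RJ − JΠ_R)·𝒢Q*` of `MsoftV_succ_sub` equals `−𝒢′(locOp′J − J·locOp)·𝒢Q* − (𝒢′J − J𝒢)·locOp·𝒢Q*` with
`locOp·𝒢Q* = Q*` ((1.95)), i.e. it CONTAINS the soft minimiser's own two-level defect `(𝒢′J − J𝒢)Q*`: §2 is an exact but EQUIVALENT
rewriting of the fine law (a smoothing-tested rate for `Π_R`'s defect on the soft field ⟺ the fine law itself), NOT a reduction to a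
smaller object — in agreement with leaf-04 gen 50's located equivalence «(R7-HCONS) ⟺ the `H_k` rate». [folklore] -/
theorem projR_eq_one_sub (ha : 0 < a) : projR n M a = 1 - (DeltaA n M a)⁻¹ * locOp n M a := by
  have hn : 1 ≤ n := Nat.one_le_iff_ne_zero.mpr (NeZero.ne n)
  have hinv : (DeltaA n M a)⁻¹ * DeltaA n M a = 1 :=
    Matrix.nonsing_inv_mul _ ((Matrix.isUnit_iff_isUnit_det _).mp (isUnit_DeltaA n hn M a ha))
  have h := congrArg (fun X => (DeltaA n M a)⁻¹ * X) (DeltaA_eq_locOp_add n M a)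
  simp only [hinv, Matrix.mul_add, ← Matrix.mul_assoc] at h
  -- h : 1 = 𝒢·locOp + 𝒢∂RT∂ᴴ
  rw [projR, eq_sub_iff_add_eq, h, add_comm]

/-- **`locOp·(𝒢Q*) = Q*`** ((1.95): the `∂R∂ᴴ` part of `Δ_a` kills the soft field). [folklore] -/
theorem locOp_mul_inv_mul_QvAdj (ha : 0 < a) : locOp n M a * ((DeltaA n M a)⁻¹ * QvAdj n M) = QvAdj n M := by
  have hn : 1 ≤ n := Nat.one_le_iff_ne_zero.mpr (NeZero.ne n)
  have h95 := eq195_left n hn M a ha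
  have hinv : DeltaA n M a * (DeltaA n M a)⁻¹ = 1 :=
    Matrix.mul_nonsing_inv _ ((Matrix.isUnit_iff_isUnit_det _).mp (isUnit_DeltaA n hn M a ha))
  have e : locOp n M a = DeltaA n M a - GradOp (fine n M) (n : ℂ) * RT n M * (GradOp (fine n M) (n : ℂ))ᴴ := by
    rw [DeltaA_eq_locOp_add]; abel
  rw [e, Matrix.sub_mul, ← Matrix.mul_assoc, hinv, Matrix.one_mul]
  have : GradOp (fine n M) (n : ℂ) * RT n M * (GradOp (fine n M) (n : ℂ))ᴴ * ((DeltaA n M a)⁻¹ * QvAdj n M)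
      = GradOp (fine n M) (n : ℂ) * (RT n M * (GradOp (fine n M) (n : ℂ))ᴴ * (DeltaA n M a)⁻¹ * QvAdj n M) := by
    simp only [Matrix.mul_assoc]
  rw [this, h95, Matrix.mul_zero, sub_zero]

end Circularity

end Summit.QuantumFields.BalabanUV.Beta.GAN24.SoftVectorMinimiserTwoLevel

end
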